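import Summits.QuantumFields.GaugeBoot.Eqs.KZL2rpD4Z11o5W22LT1
import Summits.QuantumFields.GaugeBoot.Eqs.KZL2rpD4Z11o5W22LT2
import Summits.QuantumFields.GaugeBoot.Eqs.KZL2rpD4Z11o5W22LT3
import Summits.QuantumFields.GaugeBoot.Eqs.KZL2rpD4Z11o5W22LW1
import HarnessLib

/-!
# Aggregated equality row of `SU2_D4_b11o5_kzL2rp_w2x2_lower.conic1.json` — assembly of the coded row (data)

Cell `ym-instrument` (HOME `run/shared/lean/pub/ym-instrument/`, HUMAN RULING D-0084 (2)), Lean typist seat `ym-instrument-boot-lean-1`, with the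
INHERITED generator of cell `pub-gaugeboot` seat lean2 (`pub-gaugeboot-lean2/ready/leqdata/bindZ/agg_data.py` + `gen_aggZP.py`, unchanged; kit job
j259729, referee-method cross-check `agg_xcheck_parts.py` EQUAL); crew (a) certificate row `SU2-D4-b11o5-kzL2rp-w2x2-lower` (Q-A1 R-A1.0 STEP-0, REF-3 CERT-PASS
2026-08-26T18:27:53Z).  Certificate of record `pub/ym-instrument/certs/a/files/SU2-D4/kzL2rp/SU2_D4_b11o5_kzL2rp_w2x2_lower.conic1.json` (sha256 field `f894f6226c23862c…`) over the
problem `pub/ym-instrument/certs/a/files/SU2-D4/kzL2rp/SU2_D4_b11o5_kzL2rp_w2x2_lower.problem1.json` (`SU(2)`, `D = 4`, `β_std = 11/5`, 3300 equality rows, eng2's reduced form): its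
3251 exact equality multipliers `lamQ` (dyadic rationals; sha256 of the multiplier list `7f72541721b2f009…`) contract the
equality rows into ONE row `r = Σ_e lamQ_e · row_e` (9791 labelled terms, right-hand side Σ_e lamQ_e · rhs_e = 0) — the only way
the certificate replay (lean3's `_of_feasible_agg` shape) uses the equality system.  The row is INTEGER-CODED (`Eqs/BindKitZ`: `(terms, M, K,
witness)`, terms `tz <label code> <z>` with coefficient `z / M` exactly, witness `lz <m> <def id> <position>` = an exact combination of
3214 of the family's G1 theorem rows `KZL2rpD4LitsZ*.litZ`, `μ = Σ_e lamQ_e · Λ_e` from the seat's exact elimination witnesses `Λ`,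
re-verified exactly in the seat).  Because of its size the row is spread over several modules: term pieces `…Z11o5W22LT<k>` and the
witness pieces `…Z11o5W22LW<k>` and the assembly `…Z11o5W22LR` (data only), and the final module `Eqs/KZL2rpD4Z11o5W22L` with the `m = 7` residue-class
kernel checks `chk<i>` (`Eqs/BindKitZPF.cchkZPf litZ p q 7 i` — the `BindKitZP` residue-class check with the class filter inside the combination; integer arithmetic only, one `decide` each, ≈ 21 s measured) and `Ecode`, `E_holds`, `rowSum4_row` (
`rowSum4 11/5 L r = 0` on every torus `(ℤ/L)^4` with `L ≥ 6`).  Positivity blocks and the certificate inequalities are NOT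
treated here.  GENERATED by `agg_data.py` + `gen_aggZP.py` (pub-gaugeboot lean2, of record); the span witnesses are lean2's
`ready/leqdata/bind/kzL2_D4_rp_b11-5.json` (the problem's 3300 equality rows are byte-identical to pub-gaugeboot's `beta-11-5` files of record).

HONEST FRAMING (page 1 of every file of this cell): certified bounds on lattice expectations at STATED coupling, gauge
group, dimension and torus size; NOT a mass gap, NOT a continuum limit, NOT a string tension, NOT large `N`; NOT
Yang–Mills-summit-bearing (barriers `FixedCouplingUltralocality`, `PerturbativeInvisibility`).
-/

noncomputable section

open Literature.MathematicalPhysics.QuantumFieldTheory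
open Summit.QuantumFields.GaugeBoot.BindN Summit.QuantumFields.GaugeBoot.BindZ

namespace Summit.QuantumFields.GaugeBoot.KZL2rpD4.Z11o5W22L

variable {L : ℕ} [NeZero L]

/-- The coded aggregated row `(terms, M, K, witness)`: 9791 terms in 3 pieces, `M = 28976309536083148800000` (75 bits), `K` (11 bits) = the integer scale of the check, 3214 witness entries in 1 pieces. -/
def crow : CRowZ :=
  (terms1 ++ terms2 ++ terms3, 28976309536083148800000,
   1920,
   wit1)

end Summit.QuantumFields.GaugeBoot.KZL2rpD4.Z11o5W22L

end
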